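import Literature.MathematicalPhysics.QuantumLattice.PeierlsChessboardTorusIsingType
import Literature.MathematicalPhysics.QuantumLattice.ExponentialLocalizationDiagonal
import Literature.MathematicalPhysics.QuantumLattice.InfiniteVolumeSpinEntriesProofs
import Literature.MathematicalPhysics.QuantumLattice.SpinChainsSpinSystemProofs
import HarnessLib

/-!
# Fröhlich–Lieb §III.B: exponential localization for the Ising-anisotropic quantum antiferromagnet
# (the overlap bound `Cᵢ = ⟨φᵢ, P_Λ φᵢ⟩ ≤ σ^{2d}` and the smallness datum `⟨P_Λ⟩_β ≤ R₋ + R₊`)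

Topic `MathematicalPhysics/QuantumLattice`. Fröhlich–Lieb's model (3) — the spin-`S` quantum
antiferromagnet `S⁻²Σ_{⟨ij⟩}[SᶻSᶻ + α(SˣSˣ + SʸSʸ)]` on the square lattice — becomes, after the
rotation by `π` about the `y`-axis on one sublattice (their (1.4a)), `S⁻²[H^z + αH^{xy}]` with
`H^z = -Σ S³S³` and `H^{xy} = -Σ{S¹S¹ + (iS²)(iS²)} = -Σ{S¹S¹ - S²S²} = -½Σ{S⁺S⁺ + S⁻S⁻}` ((3.32)).
In the tree this is `S²` times the member `J₁ = α`, `J₂ = -α`, `h = 0` of the Björnberg–Ueltschi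
real family, `xyzRealFieldHamiltonian L n α (-α) 0 = -Σ_{⟨xy⟩}(αS¹S¹ - αS²S² + S³S³)` (spin `n/2`),
for which the volume-uniform Peierls–chessboard chain is already typed
(`PeierlsChessboardTorusXYZ.xyzReal_sigma_twoPoint_ge_half`: long-range order once the universal
dipole projection obeys `Re⟨P_Λ⟩_β ≤ κ^{N²}` with `κ^{(b-1)/b⁵} ≤ 10⁻¹⁰`). This file supplies FL's
§III.B estimate of that smallness datum for the QUANTUM model, following the printed proof with the
tree's Theorem 3.1 / Corollary 3.2 (`Matrix.FrohlichLieb_exponentialLocalization_proj`), the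
diagonal toolkit (`Matrix.IsHermitian.hypothesisIII_of_lowering`) and the spectral split
(`Matrix.gibbsState_re_le_split_gap`):

* §1 `xyzRealFieldHamiltonian_aniso_eq`: `H(α) = H^z + α·B₀` with `H^z = H(0)` (diagonal,
  `xyzRealFieldHamiltonian_zero_eq_diagonal`) and `B₀ = H(1) - H(0) = Σ(b¹ - b⁰)` ((1.4a), (3.20));
* §2 the support of `B₀` in the `S³` basis ((3.32): "one application of `H^{xy}` … can raise
  (resp. lower) the `z`-components of the spins of ONE nearest neighbor pair by 1"):
  `flipOp_apply_ne_zero`, its vanishing diagonal, and the lowering bound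
  `isingTypeEnergy_sub_le_of_flipOp_apply_ne_zero` (`|ΔE^z| ≤ 4d·n` per application — FL's `8S`
  of Lemma 3.3 (1), here with the crude count of the bonds at the two sites);
* §3 the energies: `E(Ω) ≤ E(σ)`; the operator inequality `τ(1,-1)_{xy} ≥ -S(S+1)` by the Casimir
  sum of squares (our substitute for Anderson's bound (3.27); it gives
  `δ = (e₀^z - e₀(1))/|Λ| ≤ (d/2)·n` in tree units instead of FL's `(2S)⁻¹S²`), hence
  `e₀(1) ≥ -S(S+1)·#edges`, `e₀(1) ≤ E(Ω)` and `A = H^z - e₀(1) ≥ 0` ((3.19), (3.21));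
* §4 the unitary antisymmetry (3.22)–(3.23): `V = diag((-1)^{Σ_{z odd} σ_z})` fixes `H^z` and
  reverses `B₀` on the bipartite torus, so `±αB₀ ≤ αA` (`Matrix.pm_le_of_conj_antisymm`);
* §5 **`anisoAF_overlap_le`** — FL Prop. 3.4 in operator form, for ANY `0/1` diagonal
  projection `Q = diagonal W` whose basis states have Ising-type energy `≥ E(Ω) + G` (FL's
  universal projection `P_Λ`, (3.30)): every unit eigenvector `ψ` of `H(α)` with eigenvalue
  `≤ E(Ω) + Δ'` and every number of steps `m ≥ 1` with `(m-1)·4dn + tΔ' ≤ G` give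
  `Re⟨ψ, Qψ⟩ ≤ σ̄^{2m}`, `σ̄ = α(dnL^d/2 + tΔ')/((t-1)Δ')` ((3.24)–(3.31), Lemma 3.3, (3.35));
* §6 **`anisoAF_constrained_le`** — the smallness datum `Re⟨Q⟩_β ≤ σ̄^{2m} + (n+1)^{L^d}e^{-βΔ'}`
  ((3.1)–(3.3), (1.49)–(1.53) with the crude `Z ≥ e^{-βE(Ω)}` of Lemma 4.1).

The instantiation with the universal dipole projection of the Peierls–chessboard chain
(`exists_dipolePattern_eq_diagonal`, `G = (n²/4)N^d`), the `d = 2` packaging `κ^{N²}` and the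
long-range-order corollaries are in the sibling file `IsingAnisotropicAntiferromagnetLongRangeOrder`.
No definitions, no named facts, no sorries.

## References

* J. Fröhlich, E. H. Lieb, *Phase transitions in anisotropic lattice spin systems*, Comm. Math.
  Phys. **60** (1978) 233–267, §I.A (3) eqs. (1.3)–(1.4a), §III eqs. (3.1)–(3.3), (3.18)–(3.35),
  Lemma 3.3, Prop. 3.4, §IV.B Lemma 4.1. [FrohlichLieb1978]
* J. E. Björnberg, D. Ueltschi, *Reflection positivity and infrared bounds for quantum spin
  systems* (2022), eq. (5.15). [BjornbergUeltschi2022]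
-/

noncomputable section

open Matrix Finset
open scoped ComplexOrder MatrixOrder BigOperators
open Literature.MathematicalPhysics.QuantumLattice Literature.Probability.LatticeModels
  Literature.Barriers.CriticalPhenomena.NonGibbs

namespace Literature.MathematicalPhysics.QuantumLattice

/-! ### §1 `H(α) = H^z + α·B₀` -/

section Affine

variable {Λ : Type*} [Fintype Λ] [DecidableEq Λ] (n : ℕ)

/-- The anisotropic bond is affine in `α`:
`τ(α,-α)_{xy} = τ(0,0)_{xy} + α(τ(1,-1)_{xy} - τ(0,0)_{xy})`, i.e. `-S³S³ - α(S¹S¹ - S²S²)`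
(FL (1.3)–(1.4a): `H = S⁻²[H^z + αH^{xy}]`). [cite: FrohlichLieb1978, eqs. (1.3)–(1.4a)] -/
theorem xyzRealBond_aniso_eq (α : ℝ) (x y : Λ) :
    xyzRealBond n α (-α) 0 x y =
      xyzRealBond n 0 0 0 x y + (α : ℂ) • (xyzRealBond n 1 (-1) 0 x y - xyzRealBond n 0 0 0 x y) := by
  simp only [xyzRealBond, Pi.zero_apply, sub_self, Complex.ofReal_zero, zero_smul, sub_zero,
    ne_eq, OfNat.ofNat_ne_zero, not_false_eq_true, zero_pow, zero_div, add_zero,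
    Complex.ofReal_neg, Complex.ofReal_one, neg_smul, one_smul, sub_neg_eq_add]
  module

/-- The flip part of one bond: `τ(1,-1)_{xy} - τ(0,0)_{xy} = b¹_{xy} - b⁰_{xy} = -(S¹S¹ - S²S²)`
(FL (1.4a)/(3.32): `H^{xy} = -Σ{S¹S¹ + (iS²)(iS²)}`). [cite: FrohlichLieb1978, eqs. (1.4a), (3.32)] -/
theorem xyzRealBond_one_sub_zero (x y : Λ) :
    xyzRealBond n 1 (-1) 0 x y - xyzRealBond n 0 0 0 x y = spinBond n 1 x y - spinBond n 0 x y := by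
  simp only [xyzRealBond, Pi.zero_apply, sub_self, Complex.ofReal_zero, zero_smul, sub_zero,
    ne_eq, OfNat.ofNat_ne_zero, not_false_eq_true, zero_pow, zero_div, add_zero,
    Complex.ofReal_neg, Complex.ofReal_one, neg_smul, one_smul, sub_neg_eq_add]
  module

end Affine

section AffineTorus

variable {d : ℕ} (L : ℕ) [NeZero L] (n : ℕ)

/-- **FL (1.3)–(1.4a) in the tree's family: `H(α) = H^z + α·B₀`** with `H^z = H(0) = -Σ S³S³` and
`B₀ = H(1) - H(0) = Σ(b¹ - b⁰) = -Σ(S¹S¹ - S²S²)` (`= S²·H^{xy}`).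
[cite: FrohlichLieb1978, eqs. (1.3)–(1.4a), (3.19)–(3.20)] -/
theorem xyzRealFieldHamiltonian_aniso_eq (α : ℝ) :
    xyzRealFieldHamiltonian L n α (-α) 0 =
      xyzRealFieldHamiltonian L n 0 0 0 +
        (α : ℂ) • (xyzRealFieldHamiltonian L n 1 (-1) 0 - xyzRealFieldHamiltonian (d := d) L n 0 0 0) := by
  unfold xyzRealFieldHamiltonian
  rw [← sum_sub_distrib, smul_sum, ← sum_add_distrib]
  refine sum_congr rfl fun e _ => Sym2.inductionOn e fun x y => ?_
  simp only [Sym2.lift_mk]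
  exact xyzRealBond_aniso_eq n α x y

/-- `B₀ = H(1) - H(0)` bond by bond: `Σ_{⟨xy⟩}(b¹_{xy} - b⁰_{xy})`.
[cite: FrohlichLieb1978, eqs. (1.4a), (3.32)] -/
theorem xyzRealFieldHamiltonian_one_sub_zero :
    xyzRealFieldHamiltonian L n 1 (-1) 0 - xyzRealFieldHamiltonian (d := d) L n 0 0 0 =
      ∑ e ∈ (torusGraph d L).edgeFinset,
        Sym2.lift ⟨fun x y => spinBond n 1 x y - spinBond n 0 x y, fun x y => by
          dsimp only; rw [spinBond_comm n 1 x y, spinBond_comm n 0 x y]⟩ e := by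
  unfold xyzRealFieldHamiltonian
  rw [← sum_sub_distrib]
  refine sum_congr rfl fun e _ => Sym2.inductionOn e fun x y => ?_
  simp only [Sym2.lift_mk]
  exact xyzRealBond_one_sub_zero n x y

end AffineTorus

/-! ### §2 The support of `B₀` in the `S³` basis (FL (3.32)–(3.33)) -/

section Support

variable {Λ : Type*} [Fintype Λ] [DecidableEq Λ] (n : ℕ)

/-- `Sˣ` moves the `S³`-index by exactly one. [cite: FrohlichLieb1978, eq. (3.32)] -/
theorem spinX_apply_ne_zero {k l : Fin (n + 1)} (h : spinX n k l ≠ 0) :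
    l.val = k.val + 1 ∨ k.val = l.val + 1 := by
  by_contra hc
  push Not at hc
  apply h
  rw [spinX, Matrix.smul_apply, Matrix.add_apply, spinLower, conjTranspose_apply, spinRaise_apply,
    spinRaise_apply, if_neg hc.1, if_neg hc.2, star_zero, add_zero, smul_zero]

/-- `Sʸ` moves the `S³`-index by exactly one. [cite: FrohlichLieb1978, eq. (3.32)] -/
theorem spinY_apply_ne_zero {k l : Fin (n + 1)} (h : spinY n k l ≠ 0) :
    l.val = k.val + 1 ∨ k.val = l.val + 1 := by
  by_contra hc
  push Not at hc
  apply h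
  rw [spinY, Matrix.smul_apply, Matrix.sub_apply, spinLower, conjTranspose_apply, spinRaise_apply,
    spinRaise_apply, if_neg hc.1, if_neg hc.2, star_zero, sub_zero, smul_zero]

/-- A nonzero entry of `S^a_x S^a_y` (`x ≠ y`, `a ∈ {x, y}`-components `0, 1`) connects two
configurations that agree off `{x, y}` and differ by one unit of `S³` at `x` and at `y`.
[cite: FrohlichLieb1978, eq. (3.32)] -/
theorem siteSpin_mul_apply_ne_zero {x y : Λ} (hxy : x ≠ y) {a : Fin 3} (ha : a = 0 ∨ a = 1)
    {σ τ : TensorIndex Λ (n + 1)} (h : (siteSpin n x a * siteSpin n y a) σ τ ≠ 0) :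
    (∀ z, z ≠ x → z ≠ y → σ z = τ z) ∧
      ((τ x).val = (σ x).val + 1 ∨ (σ x).val = (τ x).val + 1) ∧
      ((τ y).val = (σ y).val + 1 ∨ (σ y).val = (τ y).val + 1) := by
  rw [siteSpin, siteSpin, onSite_mul_onSite_apply hxy] at h
  by_cases hc : ∀ z, z ≠ x → z ≠ y → σ z = τ z
  · rw [if_pos hc] at h
    have hx : spinVec n a (σ x) (τ x) ≠ 0 := left_ne_zero_of_mul h
    have hy : spinVec n a (σ y) (τ y) ≠ 0 := right_ne_zero_of_mul h
    refine ⟨hc, ?_, ?_⟩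
    · rcases ha with rfl | rfl
      · exact spinX_apply_ne_zero n (by simpa using hx)
      · exact spinY_apply_ne_zero n (by simpa using hx)
    · rcases ha with rfl | rfl
      · exact spinX_apply_ne_zero n (by simpa using hy)
      · exact spinY_apply_ne_zero n (by simpa using hy)
  · exact absurd (by rw [if_neg hc]) h

/-- A nonzero entry of the flip part `b¹_{xy} - b⁰_{xy}` of a bond (`x ≠ y`) connects two
configurations that agree off `{x, y}` and differ by one unit of `S³` at `x` and at `y` ("one
application of `H^{xy}` … can raise (resp. lower) the `z`-components of the spins of one nearest
neighbor pair by 1"). [cite: FrohlichLieb1978, eq. (3.32)] -/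
theorem spinBond_one_sub_zero_apply_ne_zero {x y : Λ} (hxy : x ≠ y) {σ τ : TensorIndex Λ (n + 1)}
    (h : (spinBond n 1 x y - spinBond n 0 x y) σ τ ≠ 0) :
    (∀ z, z ≠ x → z ≠ y → σ z = τ z) ∧
      ((τ x).val = (σ x).val + 1 ∨ (σ x).val = (τ x).val + 1) ∧
      ((τ y).val = (σ y).val + 1 ∨ (σ y).val = (τ y).val + 1) := by
  rw [spinBond_eq_mul_of_ne hxy, spinBond_eq_mul_of_ne hxy, Matrix.sub_apply] at h
  by_cases h1 : (siteSpin n x 1 * siteSpin n y 1) σ τ ≠ 0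
  · exact siteSpin_mul_apply_ne_zero n hxy (Or.inr rfl) h1
  · push Not at h1
    rw [h1, zero_sub, neg_ne_zero] at h
    exact siteSpin_mul_apply_ne_zero n hxy (Or.inl rfl) h

end Support

section SupportTorus

variable {d : ℕ} (L : ℕ) [NeZero L] (n : ℕ)

/-- **The support of `B₀ = H(1) - H(0)`** (FL (3.32)): a nonzero matrix element `⟨σ|B₀|τ⟩` forces
`σ` and `τ` to agree off one nearest-neighbour pair `⟨x, y⟩` of the torus and to differ by one unit
of `S³` at `x` and at `y`. [cite: FrohlichLieb1978, eq. (3.32)] -/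
theorem flipOp_apply_ne_zero {σ τ : TensorIndex (TorusSite d L) (n + 1)}
    (h : (xyzRealFieldHamiltonian L n 1 (-1) 0 - xyzRealFieldHamiltonian L n 0 0 0 :
      Op (TorusSite d L) (n + 1)) σ τ ≠ 0) :
    ∃ x y : TorusSite d L, (torusGraph d L).Adj x y ∧ (∀ z, z ≠ x → z ≠ y → σ z = τ z) ∧
      ((τ x).val = (σ x).val + 1 ∨ (σ x).val = (τ x).val + 1) ∧
      ((τ y).val = (σ y).val + 1 ∨ (σ y).val = (τ y).val + 1) := by
  rw [xyzRealFieldHamiltonian_one_sub_zero, Matrix.sum_apply] at h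
  obtain ⟨e, he, hne⟩ := exists_ne_zero_of_sum_ne_zero h
  revert he hne
  refine Sym2.inductionOn e fun x y => ?_
  intro he hne
  rw [SimpleGraph.mem_edgeFinset, SimpleGraph.mem_edgeSet] at he
  simp only [Sym2.lift_mk] at hne
  exact ⟨x, y, he, spinBond_one_sub_zero_apply_ne_zero n he.ne hne⟩

/-- `B₀` has no diagonal matrix elements (it changes two spins). [cite: FrohlichLieb1978, eq. (3.32)] -/
theorem flipOp_apply_self (σ : TensorIndex (TorusSite d L) (n + 1)) :
    (xyzRealFieldHamiltonian L n 1 (-1) 0 - xyzRealFieldHamiltonian L n 0 0 0 :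
      Op (TorusSite d L) (n + 1)) σ σ = 0 := by
  by_contra h
  obtain ⟨x, -, -, -, hx, -⟩ := flipOp_apply_ne_zero L n h
  omega

omit [NeZero L] in
/-- The `S³`-eigenvalues of two configurations in the support relation differ by at most one at
every site. [cite: FrohlichLieb1978, eqs. (3.32)–(3.33)] -/
private theorem ial_abs_szVal_sub_le {σ τ : TensorIndex (TorusSite d L) (n + 1)} {x y : TorusSite d L}
    (hz : ∀ z, z ≠ x → z ≠ y → σ z = τ z)
    (hx : (τ x).val = (σ x).val + 1 ∨ (σ x).val = (τ x).val + 1)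
    (hy : (τ y).val = (σ y).val + 1 ∨ (σ y).val = (τ y).val + 1) (p : TorusSite d L) :
    |szVal n (τ p) - szVal n (σ p)| ≤ 1 := by
  have key : ((τ p).val : ℝ) = (σ p).val + 1 ∨ ((σ p).val : ℝ) = (τ p).val + 1 ∨ σ p = τ p := by
    by_cases hpx : p = x
    · subst hpx
      rcases hx with h | h
      · exact Or.inl (by exact_mod_cast h)
      · exact Or.inr (Or.inl (by exact_mod_cast h))
    · by_cases hpy : p = y
      · subst hpy
        rcases hy with h | h
        · exact Or.inl (by exact_mod_cast h)
        · exact Or.inr (Or.inl (by exact_mod_cast h))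
      · exact Or.inr (Or.inr (hz p hpx hpy))
  simp only [szVal]
  rcases key with h | h | h
  · rw [h, abs_le]; constructor <;> linarith
  · rw [h, abs_le]; constructor <;> linarith
  · rw [h, sub_self, abs_zero]; exact zero_le_one

omit [NeZero L] in
/-- One bond energy changes by at most `n` along the support relation:
`|s(τ_p)s(τ_q) - s(σ_p)s(σ_q)| ≤ n` (`|s| ≤ n/2`, `|Δs| ≤ 1`). [cite: FrohlichLieb1978, eq. (3.33)] -/
private theorem ial_bond_sub_le {σ τ : TensorIndex (TorusSite d L) (n + 1)} {x y : TorusSite d L}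
    (hz : ∀ z, z ≠ x → z ≠ y → σ z = τ z)
    (hx : (τ x).val = (σ x).val + 1 ∨ (σ x).val = (τ x).val + 1)
    (hy : (τ y).val = (σ y).val + 1 ∨ (σ y).val = (τ y).val + 1) (e : Sym2 (TorusSite d L)) :
    Sym2.lift ⟨fun p q => -(szVal n (τ p) * szVal n (τ q)), fun _ _ => by ring⟩ e -
        Sym2.lift ⟨fun p q => -(szVal n (σ p) * szVal n (σ q)), fun _ _ => by ring⟩ e ≤ n := by
  induction e using Sym2.ind with
  | h p q =>
    simp only [Sym2.lift_mk]
    have hp := ial_abs_szVal_sub_le L n hz hx hy p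
    have hq := ial_abs_szVal_sub_le L n hz hx hy q
    have htq := abs_szVal_le n (τ q)
    have hsp := abs_szVal_le n (σ p)
    have hid : -(szVal n (τ p) * szVal n (τ q)) - -(szVal n (σ p) * szVal n (σ q)) =
        -((szVal n (τ p) - szVal n (σ p)) * szVal n (τ q) +
          szVal n (σ p) * (szVal n (τ q) - szVal n (σ q))) := by ring
    rw [hid]
    calc -((szVal n (τ p) - szVal n (σ p)) * szVal n (τ q) +
          szVal n (σ p) * (szVal n (τ q) - szVal n (σ q)))
        ≤ |(szVal n (τ p) - szVal n (σ p)) * szVal n (τ q) +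
            szVal n (σ p) * (szVal n (τ q) - szVal n (σ q))| := neg_le_abs _
      _ ≤ |szVal n (τ p) - szVal n (σ p)| * |szVal n (τ q)| +
            |szVal n (σ p)| * |szVal n (τ q) - szVal n (σ q)| := by
          refine (abs_add_le _ _).trans ?_
          rw [abs_mul, abs_mul]
      _ ≤ 1 * ((n : ℝ) / 2) + (n : ℝ) / 2 * 1 := by
          gcongr
      _ = n := by ring

omit [NeZero L] in
/-- A bond not meeting the flipped pair keeps its energy. [cite: FrohlichLieb1978, eq. (3.33)] -/
private theorem ial_bond_sub_eq_zero {σ τ : TensorIndex (TorusSite d L) (n + 1)}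
    {x y : TorusSite d L} (hz : ∀ z, z ≠ x → z ≠ y → σ z = τ z) {e : Sym2 (TorusSite d L)}
    (hex : x ∉ e) (hey : y ∉ e) :
    Sym2.lift ⟨fun p q => -(szVal n (τ p) * szVal n (τ q)), fun _ _ => by ring⟩ e -
        Sym2.lift ⟨fun p q => -(szVal n (σ p) * szVal n (σ q)), fun _ _ => by ring⟩ e = 0 := by
  induction e using Sym2.ind with
  | h p q =>
    simp only [Sym2.lift_mk]
    rw [Sym2.mem_iff, not_or] at hex hey
    rw [hz p (Ne.symm hex.1) (Ne.symm hey.1), hz q (Ne.symm hex.2) (Ne.symm hey.2), sub_self]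

/-- At most `2d` bonds of the torus contain a given site (they are among the `s(x, x ± eᵢ)`).
[cite: FriedliVelenik2017, §3.1] -/
private theorem ial_card_filter_mem_le (x : TorusSite d L) :
    ((torusGraph d L).edgeFinset.filter fun e => x ∈ e).card ≤ 2 * d := by
  classical
  calc ((torusGraph d L).edgeFinset.filter fun e => x ∈ e).card
      ≤ ((univ : Finset (Fin d × Bool)).image fun p =>
          if p.2 then s(x, x + Pi.single p.1 1) else s(x, x - Pi.single p.1 1)).card := by
        refine card_le_card fun e he => ?_
        rw [mem_filter] at he
        obtain ⟨he, hxe⟩ := he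
        obtain ⟨c, rfl⟩ : ∃ c, e = s(x, c) := by
          induction e using Sym2.ind with
          | h p q =>
            rcases Sym2.mem_iff.1 hxe with rfl | rfl
            · exact ⟨q, rfl⟩
            · exact ⟨p, Sym2.eq_swap⟩
        rw [SimpleGraph.mem_edgeFinset, SimpleGraph.mem_edgeSet, torusGraph_adj_iff] at he
        simp only [mem_image, mem_univ, true_and, Prod.exists]
        rcases he.2 with ⟨i, hi⟩ | ⟨i, hi⟩
        · exact ⟨i, true, by rw [if_pos rfl, hi]⟩
        · exact ⟨i, false, by rw [if_neg Bool.false_ne_true, hi, add_sub_cancel_right]⟩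
    _ ≤ (univ : Finset (Fin d × Bool)).card := card_image_le
    _ = 2 * d := by simp [mul_comm]

/-- **FL Lemma 3.3 (1), the lowering constant.** Along a nonzero matrix element of `B₀` the
Ising-type energy changes by at most `4d·n`: only the (at most `4d`) bonds meeting the flipped
pair change, each by at most `n` ("this cannot change the minimal `A`-energy of `ψ` by more than
`S⁻²·8S`"). [cite: FrohlichLieb1978, Lemma 3.3 (1), eqs. (3.32)–(3.33)] -/
theorem isingTypeEnergy_sub_le_of_flipOp_apply_ne_zero {σ τ : TensorIndex (TorusSite d L) (n + 1)}
    (h : (xyzRealFieldHamiltonian L n 1 (-1) 0 - xyzRealFieldHamiltonian L n 0 0 0 :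
      Op (TorusSite d L) (n + 1)) σ τ ≠ 0) :
    isingTypeEnergy n L τ - isingTypeEnergy n L σ ≤ 4 * d * n := by
  classical
  obtain ⟨x, y, -, hz, hx, hy⟩ := flipOp_apply_ne_zero L n h
  set E := (torusGraph d L).edgeFinset with hE
  set I := E.filter fun e => x ∈ e ∨ y ∈ e with hI
  set g : Sym2 (TorusSite d L) → ℝ := fun e =>
    Sym2.lift ⟨fun p q => -(szVal n (τ p) * szVal n (τ q)), fun _ _ => by ring⟩ e -
      Sym2.lift ⟨fun p q => -(szVal n (σ p) * szVal n (σ q)), fun _ _ => by ring⟩ e with hg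
  have hdiff : isingTypeEnergy n L τ - isingTypeEnergy n L σ = ∑ e ∈ E, g e := by
    rw [isingTypeEnergy, isingTypeEnergy, ← sum_sub_distrib]
  have hsplit : ∑ e ∈ E, g e = ∑ e ∈ I, g e := by
    rw [hI, sum_filter]
    refine sum_congr rfl fun e _ => ?_
    split_ifs with hmem
    · rfl
    · rw [not_or] at hmem
      exact ial_bond_sub_eq_zero L n hz hmem.1 hmem.2
  have hIcard : (I.card : ℝ) ≤ 4 * d := by
    have h1 : I ⊆ (E.filter fun e => x ∈ e) ∪ E.filter fun e => y ∈ e := by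
      intro e he
      rw [hI, mem_filter] at he
      rw [mem_union, mem_filter, mem_filter]
      tauto
    have h2 := (card_le_card h1).trans (card_union_le _ _)
    have h3 : (E.filter fun e => x ∈ e).card ≤ 2 * d := by rw [hE]; exact ial_card_filter_mem_le L x
    have h4 : (E.filter fun e => y ∈ e).card ≤ 2 * d := by rw [hE]; exact ial_card_filter_mem_le L y
    have : I.card ≤ 4 * d := by omega
    exact_mod_cast this
  rw [hdiff, hsplit]
  calc ∑ e ∈ I, g e ≤ ∑ _e ∈ I, (n : ℝ) := sum_le_sum fun e _ => ial_bond_sub_le L n hz hx hy e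
    _ = I.card * n := by rw [sum_const, nsmul_eq_mul]
    _ ≤ 4 * d * n := by gcongr

end SupportTorus

/-! ### §3 Energies: `E(Ω) ≤ E(σ)`, `-S(S+1)·#bonds ≤ e₀(1) ≤ E(Ω)`, `A = H^z - e₀(1) ≥ 0` -/

section Energies

variable {Λ : Type*} [Fintype Λ] [DecidableEq Λ] (n : ℕ)

/-- **The antiferromagnetic bond is bounded below by `-S(S+1)`** (the Casimir sum of squares
`(S¹_x-S¹_y)² + (S²_x+S²_y)² + (S³_x-S³_y)² = 2S(S+1) + 2τ(1,-1)_{xy} ≥ 0`; our replacement for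
Anderson's lower bound on `e₀(α = 1)` in FL (3.27)): `τ(1,-1)_{xy} + S(S+1)·1 ≥ 0`, `S = n/2`.
[cite: FrohlichLieb1978, eqs. (3.26)–(3.28)] -/
theorem xyzRealBond_one_add_posSemidef (x y : Λ) :
    (xyzRealBond n 1 (-1) 0 x y + ((n : ℂ) / 2 * ((n : ℂ) / 2 + 1)) • (1 : Op Λ (n + 1))).PosSemidef := by
  set X : Fin 3 → Op Λ (n + 1) := fun a => siteSpin n x a with hX
  set Y : Fin 3 → Op Λ (n + 1) := fun a => siteSpin n y a with hY
  have hXh : ∀ a, (X a)ᴴ = X a := fun a => (siteSpin_isHermitian n x a).eq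
  have hYh : ∀ a, (Y a)ᴴ = Y a := fun a => (siteSpin_isHermitian n y a).eq
  have hcX : X 0 * X 0 + X 1 * X 1 + X 2 * X 2 = ((n : ℂ) / 2 * ((n : ℂ) / 2 + 1)) • 1 := by
    have h := sum_siteSpin_mul_siteSpin_holds (Λ := Λ) n x
    rw [Fin.sum_univ_three] at h
    exact h
  have hcY : Y 0 * Y 0 + Y 1 * Y 1 + Y 2 * Y 2 = ((n : ℂ) / 2 * ((n : ℂ) / 2 + 1)) • 1 := by
    have h := sum_siteSpin_mul_siteSpin_holds (Λ := Λ) n y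
    rw [Fin.sum_univ_three] at h
    exact h
  -- the three squares
  set M₀ := X 0 - Y 0 with hM₀
  set M₁ := X 1 + Y 1 with hM₁
  set M₂ := X 2 - Y 2 with hM₂
  have hpsd : ((1 / 2 : ℂ) • (M₀ᴴ * M₀ + M₁ᴴ * M₁ + M₂ᴴ * M₂)).PosSemidef :=
    (((posSemidef_conjTranspose_mul_self M₀).add (posSemidef_conjTranspose_mul_self M₁)).add
      (posSemidef_conjTranspose_mul_self M₂)).smul (by
        rw [show (1 / 2 : ℂ) = ((1 / 2 : ℝ) : ℂ) by push_cast; ring]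
        exact Complex.zero_le_real.2 (by norm_num))
  have hM₀h : M₀ᴴ = M₀ := by rw [hM₀, conjTranspose_sub, hXh, hYh]
  have hM₁h : M₁ᴴ = M₁ := by rw [hM₁, conjTranspose_add, hXh, hYh]
  have hM₂h : M₂ᴴ = M₂ := by rw [hM₂, conjTranspose_sub, hXh, hYh]
  rw [hM₀h, hM₁h, hM₂h] at hpsd
  -- the bond in terms of the products
  have hbond : xyzRealBond n 1 (-1) 0 x y =
      -((1 / 2 : ℂ) • (X 0 * Y 0 + Y 0 * X 0)) + (1 / 2 : ℂ) • (X 1 * Y 1 + Y 1 * X 1) -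
        (1 / 2 : ℂ) • (X 2 * Y 2 + Y 2 * X 2) := by
    simp only [xyzRealBond, spinBond, hX, hY, Pi.zero_apply, sub_self, Complex.ofReal_zero,
      zero_smul, sub_zero, ne_eq, OfNat.ofNat_ne_zero, not_false_eq_true, zero_pow, zero_div,
      add_zero, Complex.ofReal_neg, Complex.ofReal_one, neg_smul, one_smul, sub_neg_eq_add]
  have hc1 : ((n : ℂ) / 2 * ((n : ℂ) / 2 + 1)) • (1 : Op Λ (n + 1)) =
      (1 / 2 : ℂ) • (X 0 * X 0 + X 1 * X 1 + X 2 * X 2) +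
        (1 / 2 : ℂ) • (Y 0 * Y 0 + Y 1 * Y 1 + Y 2 * Y 2) := by
    rw [hcX, hcY, ← add_smul]
    norm_num
  have key : xyzRealBond n 1 (-1) 0 x y + ((n : ℂ) / 2 * ((n : ℂ) / 2 + 1)) • (1 : Op Λ (n + 1)) =
      (1 / 2 : ℂ) • (M₀ * M₀ + M₁ * M₁ + M₂ * M₂) := by
    rw [hbond, hc1, hM₀, hM₁, hM₂]
    simp only [sub_mul, mul_sub, add_mul, mul_add, smul_add, smul_sub]
    module
  rw [key]
  exact hpsd

end Energies

section EnergiesTorus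

variable {d : ℕ} (L : ℕ) [NeZero L] (n : ℕ)

/-- The aligned configuration minimises the Ising-type energy: `E(Ω) ≤ E(σ)` (every bond is
`≥ -n²/4`). [cite: FrohlichLieb1978, §III eq. (3.21)] -/
theorem isingTypeEnergy_zero_le (σ : TensorIndex (TorusSite d L) (n + 1)) :
    isingTypeEnergy n L (fun _ : TorusSite d L => (0 : Fin (n + 1))) ≤ isingTypeEnergy n L σ := by
  rw [isingTypeEnergy_zero, isingTypeEnergy]
  calc -((n : ℝ) ^ 2 / 4) * ((torusGraph d L).edgeFinset.card : ℝ)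
      = ∑ _e ∈ (torusGraph d L).edgeFinset, -((n : ℝ) ^ 2 / 4) := by
        rw [sum_const, nsmul_eq_mul, mul_comm]
    _ ≤ _ := sum_le_sum fun e _ => neg_le_isingTypeBond n L σ e

/-- Every site of the torus has degree `≤ 2d`. [cite: FriedliVelenik2017, §3.1] -/
private theorem ial_degree_le (x : TorusSite d L) : (torusGraph d L).degree x ≤ 2 * d := by
  classical
  rw [← SimpleGraph.card_neighborFinset_eq_degree, SimpleGraph.neighborFinset_eq_filter]
  calc #({w | (torusGraph d L).Adj x w} : Finset (TorusSite d L))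
      ≤ ((univ : Finset (Fin d × Bool)).image fun p =>
          if p.2 then x + Pi.single p.1 1 else x - Pi.single p.1 1).card := by
        refine card_le_card fun w hw => ?_
        rw [mem_filter] at hw
        have hw' := (torusGraph_adj_iff x w).1 hw.2
        simp only [mem_image, mem_univ, true_and, Prod.exists]
        rcases hw'.2 with ⟨i, hi⟩ | ⟨i, hi⟩
        · exact ⟨i, true, by rw [if_pos rfl, hi]⟩
        · exact ⟨i, false, by rw [if_neg Bool.false_ne_true, hi, add_sub_cancel_right]⟩
    _ ≤ (univ : Finset (Fin d × Bool)).card := card_image_le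
    _ = 2 * d := by simp [mul_comm]

/-- The torus has at most `d·L^d` bonds (handshake). [cite: FriedliVelenik2017, §3.1] -/
theorem card_edgeFinset_torusGraph_le : (torusGraph d L).edgeFinset.card ≤ d * L ^ d := by
  classical
  have h := SimpleGraph.sum_degrees_eq_twice_card_edges (torusGraph d L)
  have h2 : ∑ v : TorusSite d L, (torusGraph d L).degree v ≤ ∑ _v : TorusSite d L, 2 * d :=
    sum_le_sum fun v _ => ial_degree_le L v
  have hcard : (Fintype.card (TorusSite d L)) = L ^ d := by
    rw [Fintype.card_pi, prod_const, card_univ, ZMod.card, Fintype.card_fin]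
  rw [sum_const, card_univ, smul_eq_mul, hcard] at h2
  have h3 : 2 * (torusGraph d L).edgeFinset.card ≤ 2 * (d * L ^ d) := by
    calc 2 * (torusGraph d L).edgeFinset.card = ∑ v : TorusSite d L, (torusGraph d L).degree v := h.symm
      _ ≤ L ^ d * (2 * d) := h2
      _ = 2 * (d * L ^ d) := by ring
  exact Nat.le_of_mul_le_mul_left h3 (by norm_num)

/-- **`e₀(α = 1) ≥ -S(S+1)·#bonds`**: `H(1) + S(S+1)·#bonds·1 ≥ 0` (sum of the bond inequalities
`xyzRealBond_one_add_posSemidef`). [cite: FrohlichLieb1978, eqs. (3.27)–(3.28)] -/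
theorem xyzRealFieldHamiltonian_one_add_posSemidef :
    (xyzRealFieldHamiltonian L n 1 (-1) 0 +
      (((torusGraph d L).edgeFinset.card : ℂ) * ((n : ℂ) / 2 * ((n : ℂ) / 2 + 1))) •
        (1 : Op (TorusSite d L) (n + 1))).PosSemidef := by
  have hsum : xyzRealFieldHamiltonian L n 1 (-1) 0 +
      (((torusGraph d L).edgeFinset.card : ℂ) * ((n : ℂ) / 2 * ((n : ℂ) / 2 + 1))) •
        (1 : Op (TorusSite d L) (n + 1)) =
      ∑ e ∈ (torusGraph d L).edgeFinset,
        (Sym2.lift ⟨fun x y => xyzRealBond n 1 (-1) 0 x y, fun _ _ => xyzRealBond_comm n 1 (-1) 0 _ _⟩ e +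
          ((n : ℂ) / 2 * ((n : ℂ) / 2 + 1)) • (1 : Op (TorusSite d L) (n + 1))) := by
    rw [sum_add_distrib, sum_const, ← Nat.cast_smul_eq_nsmul ℂ, smul_smul]
    rfl
  rw [hsum]
  refine Finset.sum_induction _ (fun M : Op (TorusSite d L) (n + 1) => M.PosSemidef)
    (fun a b ha hb => ha.add hb) PosSemidef.zero fun e he => ?_
  clear he
  refine Sym2.inductionOn e fun x y => ?_
  simp only [Sym2.lift_mk]
  exact xyzRealBond_one_add_posSemidef n x y

/-- The eigenvectors of the spectral theorem are unit vectors for the dot product. [folklore] -/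
private theorem ial_star_eigenvectorBasis_dotProduct {m : Type*} [Fintype m] [DecidableEq m]
    {H : Matrix m m ℂ} (hH : H.IsHermitian) (i : m) :
    star (⇑(hH.eigenvectorBasis i) : m → ℂ) ⬝ᵥ ⇑(hH.eigenvectorBasis i) = 1 := by
  have hUU' : star (hH.eigenvectorUnitary : Matrix m m ℂ) * (hH.eigenvectorUnitary : Matrix m m ℂ) = 1 :=
    Unitary.star_mul_self_of_mem hH.eigenvectorUnitary.prop
  have h := congrFun (congrFun hUU' i) i
  rw [Matrix.one_apply_eq] at h
  rw [← h]
  simp only [mul_apply, star_apply, dotProduct, Pi.star_apply, IsHermitian.eigenvectorUnitary_apply]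

/-- A lower operator bound is a lower bound on the ground-state energy: `H + c ≥ 0 ⇒ E₀(H) ≥ -c`.
[folklore] -/
private theorem ial_neg_le_groundEnergy {m : Type*} [Fintype m] [DecidableEq m] [Nonempty m]
    {H : Matrix m m ℂ} (hH : H.IsHermitian) {c : ℝ}
    (hc : (H + (c : ℂ) • (1 : Matrix m m ℂ)).PosSemidef) : -c ≤ H.groundEnergy := by
  obtain ⟨i₀, hi₀⟩ : ∃ i, hH.eigenvalues i = H.groundEnergy := by
    rw [Matrix.groundEnergy_eq_iInf_eigenvalues_holds hH]
    exact exists_eq_ciInf_of_finite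
  set u : m → ℂ := ⇑(hH.eigenvectorBasis i₀) with hu
  have hu1 : star u ⬝ᵥ u = 1 := ial_star_eigenvectorBasis_dotProduct hH i₀
  have hHu : H *ᵥ u = ((hH.eigenvalues i₀ : ℝ) : ℂ) • u := by
    rw [hu, hH.mulVec_eigenvectorBasis i₀, RCLike.real_smul_eq_coe_smul (K := ℂ)]
    rfl
  have h := (Complex.nonneg_iff.1 (hc.dotProduct_mulVec_nonneg u)).1
  rw [add_mulVec, smul_mulVec, one_mulVec, hHu, dotProduct_add, dotProduct_smul, dotProduct_smul,
    hu1, smul_eq_mul, mul_one, smul_eq_mul, mul_one, Complex.add_re, Complex.ofReal_re,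
    Complex.ofReal_re, hi₀] at h
  linarith

/-- **`e₀(1) ≥ -S(S+1)·#bonds ≥ -(d/2)·S(S+1)... `**: the ground-state energy of the isotropic
member is at least `-#bonds·(n/2)(n/2+1)`. [cite: FrohlichLieb1978, eqs. (3.27)–(3.28)] -/
theorem neg_le_groundEnergy_xyzRealFieldHamiltonian_one :
    -(((torusGraph d L).edgeFinset.card : ℝ) * ((n : ℝ) / 2 * ((n : ℝ) / 2 + 1))) ≤
      (xyzRealFieldHamiltonian L n 1 (-1) (0 : TorusSite d L → ℝ)).groundEnergy := by
  haveI : Nonempty (TensorIndex (TorusSite d L) (n + 1)) := ⟨fun _ => 0⟩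
  refine ial_neg_le_groundEnergy (xyzRealFieldHamiltonian_isHermitian L n 1 (-1) 0) ?_
  have h := xyzRealFieldHamiltonian_one_add_posSemidef L n (d := d)
  push_cast
  exact h

/-- **The basis states are trial states: `⟨σ|H(α)|σ⟩ = E(σ)`** (the flip part has no diagonal).
[cite: FrohlichLieb1978, eq. (3.21), Lemma 4.1] -/
theorem xyzRealFieldHamiltonian_aniso_apply_self (α : ℝ) (σ : TensorIndex (TorusSite d L) (n + 1)) :
    xyzRealFieldHamiltonian L n α (-α) 0 σ σ = ((isingTypeEnergy n L σ : ℝ) : ℂ) := by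
  rw [xyzRealFieldHamiltonian_aniso_eq, Matrix.add_apply, Matrix.smul_apply, flipOp_apply_self,
    smul_zero, add_zero, xyzRealFieldHamiltonian_zero_eq_diagonal, diagonal_apply_eq]

/-- **`e₀(α) ≤ E(Ω)`** for every `α` (the aligned basis state as a trial state; FL (3.21): "the
groundstate energy `e₀(α = 1)` … is bounded above by the groundstate energy `e₀^z` of `S⁻²H^z`").
[cite: FrohlichLieb1978, eq. (3.21)] -/
theorem groundEnergy_xyzRealFieldHamiltonian_aniso_le (α : ℝ) :
    (xyzRealFieldHamiltonian L n α (-α) (0 : TorusSite d L → ℝ)).groundEnergy ≤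
      isingTypeEnergy n L (fun _ : TorusSite d L => (0 : Fin (n + 1))) := by
  set φ : TensorIndex (TorusSite d L) (n + 1) → ℂ := Pi.single (fun _ => 0) 1 with hφ
  have hφ1 : star φ ⬝ᵥ φ = 1 := by
    rw [hφ, dotProduct_single, Pi.star_apply, Pi.single_eq_same, star_one, mul_one]
  have h := Matrix.groundEnergy_le_rayleigh_holds (xyzRealFieldHamiltonian_isHermitian L n α (-α) 0)
    φ hφ1
  rwa [hφ, mulVec_single_one, ← Pi.single_star, star_one, single_dotProduct, one_mul,
    Matrix.col_apply, xyzRealFieldHamiltonian_aniso_apply_self, Complex.ofReal_re] at h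

/-- **`A = H^z - e₀(1)` is the diagonal matrix `diag(E(σ) - e₀(1))`** (FL (3.19)).
[cite: FrohlichLieb1978, eq. (3.19)] -/
theorem xyzRealFieldHamiltonian_zero_sub_eq_diagonal (c : ℝ) :
    xyzRealFieldHamiltonian L n 0 0 0 - (c : ℂ) • (1 : Op (TorusSite d L) (n + 1)) =
      diagonal fun σ => (((isingTypeEnergy n L σ - c : ℝ)) : ℂ) := by
  rw [xyzRealFieldHamiltonian_zero_eq_diagonal, smul_one_eq_diagonal, diagonal_sub]
  congr 1
  funext σ
  push_cast
  ring

/-- **`A = H^z - e₀(1) ≥ 0`** (FL (3.21): `E(σ) ≥ E(Ω) = e₀^z ≥ e₀(1)`).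
[cite: FrohlichLieb1978, eqs. (3.19), (3.21)] -/
theorem xyzRealFieldHamiltonian_zero_sub_groundEnergy_posSemidef :
    (xyzRealFieldHamiltonian L n 0 0 0 -
      ((xyzRealFieldHamiltonian L n 1 (-1) (0 : TorusSite d L → ℝ)).groundEnergy : ℂ) •
        (1 : Op (TorusSite d L) (n + 1))).PosSemidef := by
  rw [xyzRealFieldHamiltonian_zero_sub_eq_diagonal, posSemidef_diagonal_iff]
  intro σ
  rw [Complex.zero_le_real, sub_nonneg]
  exact (groundEnergy_xyzRealFieldHamiltonian_aniso_le L n 1).trans (isingTypeEnergy_zero_le L n σ)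

end EnergiesTorus

/-! ### §4 The unitary antisymmetry (FL (3.22)–(3.23)) -/

section Antisymmetry

variable {d : ℕ} (L : ℕ) [NeZero L] (n : ℕ)

omit [NeZero L] in
/-- Nearest neighbours of the even torus lie on different sublattices. [cite: DLS1978, §2] -/
private theorem ial_parity_ne_of_adj (hL : Even L) {x y : TorusSite d L}
    (h : (torusGraph d L).Adj x y) : torusSiteParity L hL x ≠ torusSiteParity L hL y := by
  have h01 : ∀ p : ZMod 2, p ≠ p + 1 := by decide
  rcases ((torusGraph_adj_iff x y).1 h).2 with ⟨i, hi⟩ | ⟨i, hi⟩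
  · rw [hi, torusSiteParity_add_single]; exact h01 _
  · rw [hi, torusSiteParity_add_single]; exact (h01 _).symm

/-- The sign `(-1)^{Σ_{z odd} σ_z}` of a basis configuration (the diagonal of the rotation by `π`
about the `3`-axis on the odd sublattice, up to a global phase). [cite: FrohlichLieb1978, eq. (3.23)] -/
private theorem ial_sign_mul_sign_of_flip (hL : Even L) {σ τ : TensorIndex (TorusSite d L) (n + 1)}
    {x y : TorusSite d L} (hxy : (torusGraph d L).Adj x y) (hz : ∀ z, z ≠ x → z ≠ y → σ z = τ z)
    (hx : (τ x).val = (σ x).val + 1 ∨ (σ x).val = (τ x).val + 1)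
    (hy : (τ y).val = (σ y).val + 1 ∨ (σ y).val = (τ y).val + 1) :
    ((-1 : ℂ) ^ ∑ z ∈ univ.filter (fun z => torusSiteParity L hL z ≠ 0), (σ z).val) *
        (-1 : ℂ) ^ ∑ z ∈ univ.filter (fun z => torusSiteParity L hL z ≠ 0), (τ z).val = -1 := by
  classical
  set O := univ.filter (fun z : TorusSite d L => torusSiteParity L hL z ≠ 0) with hO
  have hpar := ial_parity_ne_of_adj L hL hxy
  -- the odd endpoint `w` and the even endpoint `w'`
  obtain ⟨w, w', hwO, hw'O, hww', hw, hrest⟩ : ∃ w w' : TorusSite d L, w ∈ O ∧ w' ∉ O ∧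
      ({x, y} : Finset _) = {w, w'} ∧
      ((τ w).val = (σ w).val + 1 ∨ (σ w).val = (τ w).val + 1) ∧
      ∀ z, z ≠ w → z ≠ w' → σ z = τ z := by
    by_cases hxO : torusSiteParity L hL x ≠ 0
    · have hyO : torusSiteParity L hL y = 0 := by
        have h01 : ∀ p q : ZMod 2, p ≠ 0 → p ≠ q → q = 0 := by decide
        exact h01 _ _ hxO hpar
      refine ⟨x, y, mem_filter.2 ⟨mem_univ _, hxO⟩, fun h => (mem_filter.1 h).2 hyO, rfl, hx, hz⟩
    · push Not at hxO
      have hyO : torusSiteParity L hL y ≠ 0 := fun h => hpar (hxO.trans h.symm)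
      refine ⟨y, x, mem_filter.2 ⟨mem_univ _, hyO⟩, fun h => (mem_filter.1 h).2 hxO, pair_comm _ _,
        hy, fun z h1 h2 => hz z h2 h1⟩
  have hsplit : ∀ ρ : TensorIndex (TorusSite d L) (n + 1),
      ∑ z ∈ O, (ρ z).val = (ρ w).val + ∑ z ∈ O.erase w, (ρ z).val := fun ρ =>
    (add_sum_erase O (fun z => (ρ z).val) hwO).symm
  have hrest' : ∑ z ∈ O.erase w, (σ z).val = ∑ z ∈ O.erase w, (τ z).val := by
    refine sum_congr rfl fun z hz' => ?_
    have hzw : z ≠ w := ne_of_mem_erase hz'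
    have hzw' : z ≠ w' := fun h => hw'O (h ▸ mem_of_mem_erase hz')
    rw [hrest z hzw hzw']
  rw [← pow_add, hsplit σ, hsplit τ, hrest']
  have hodd : Odd ((σ w).val + ∑ z ∈ O.erase w, (τ z).val + ((τ w).val + ∑ z ∈ O.erase w, (τ z).val)) := by
    rcases hw with h | h
    · exact ⟨(σ w).val + ∑ z ∈ O.erase w, (τ z).val, by omega⟩
    · exact ⟨(τ w).val + ∑ z ∈ O.erase w, (τ z).val, by omega⟩
  exact hodd.neg_one_pow

/-- **The sublattice rotation `V = diag((-1)^{Σ_{z odd} σ_z})` fixes `H^z` and reverses `B₀`** on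
the bipartite (even) torus: `VVᴴ = 1`, `V(H^z - c)Vᴴ = H^z - c`, `VB₀Vᴴ = -B₀` ("if we rotate all
spins on one of the sublattices by an angle `π` around the `z`-axis … `H^{xy}` is taken into
`-H^{xy}` … but `H^z` is unchanged"). [cite: FrohlichLieb1978, eqs. (3.22)–(3.23)] -/
theorem exists_conj_antisymm_flipOp (hL : Even L) (c : ℂ) :
    ∃ V : Op (TorusSite d L) (n + 1), V * Vᴴ = 1 ∧
      V * (xyzRealFieldHamiltonian (d := d) L n 0 0 0 - c • 1) * Vᴴ =
        xyzRealFieldHamiltonian L n 0 0 0 - c • 1 ∧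
      V * (xyzRealFieldHamiltonian L n 1 (-1) 0 - xyzRealFieldHamiltonian L n 0 0 0) * Vᴴ =
        -(xyzRealFieldHamiltonian L n 1 (-1) 0 - xyzRealFieldHamiltonian L n 0 0 0) := by
  classical
  set O := univ.filter (fun z : TorusSite d L => torusSiteParity L hL z ≠ 0) with hO
  set v : TensorIndex (TorusSite d L) (n + 1) → ℂ := fun σ => (-1 : ℂ) ^ ∑ z ∈ O, (σ z).val with hv
  have hvstar : star v = v := by
    funext σ
    rw [Pi.star_apply, hv]
    simp only [star_pow, star_neg, star_one]
  have hvv : ∀ σ, v σ * v σ = 1 := fun σ => by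
    rw [hv]
    simp only [← pow_add, ← two_mul, pow_mul, neg_one_sq, one_pow]
  refine ⟨diagonal v, ?_, ?_, ?_⟩
  · rw [diagonal_conjTranspose, hvstar, diagonal_mul_diagonal, ← diagonal_one]
    congr 1
    funext σ
    exact hvv σ
  · set B := xyzRealFieldHamiltonian L n 0 0 0 - c • (1 : Op (TorusSite d L) (n + 1)) with hB
    have hBd : B = diagonal fun σ => ((isingTypeEnergy n L σ : ℝ) : ℂ) - c := by
      rw [hB, xyzRealFieldHamiltonian_zero_eq_diagonal, smul_one_eq_diagonal, diagonal_sub]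
    rw [hBd, diagonal_conjTranspose, hvstar, diagonal_mul_diagonal, diagonal_mul_diagonal]
    congr 1
    funext σ
    rw [mul_right_comm, hvv σ, one_mul]
  · ext σ τ
    rw [diagonal_conjTranspose, hvstar, mul_diagonal, diagonal_mul, Matrix.neg_apply]
    by_cases h0 : (xyzRealFieldHamiltonian L n 1 (-1) 0 - xyzRealFieldHamiltonian L n 0 0 0 :
        Op (TorusSite d L) (n + 1)) σ τ = 0
    · rw [h0, mul_zero, zero_mul, neg_zero]
    · obtain ⟨x, y, hxy, hz, hx, hy⟩ := flipOp_apply_ne_zero L n h0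
      have hsign : v σ * v τ = -1 := ial_sign_mul_sign_of_flip L n hL hxy hz hx hy
      rw [mul_right_comm, hsign, neg_one_mul]

/-- **FL (3.23): `±αB₀ ≤ α(H^z - e₀(1))`** for `0 < α` on the even torus (from
`A + α⁻¹·αB₀ = H(1) - e₀(1) ≥ 0`, (3.22), and the sublattice antisymmetry).
[cite: FrohlichLieb1978, eqs. (3.22)–(3.23)] -/
theorem flipOp_pm_le (hL : Even L) {α : ℝ} (hα : 0 < α) :
    ((α : ℂ) • (xyzRealFieldHamiltonian (d := d) L n 0 0 0 -
        ((xyzRealFieldHamiltonian L n 1 (-1) (0 : TorusSite d L → ℝ)).groundEnergy : ℂ) • 1) +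
      (α : ℂ) • (xyzRealFieldHamiltonian L n 1 (-1) 0 - xyzRealFieldHamiltonian L n 0 0 0)).PosSemidef ∧
    ((α : ℂ) • (xyzRealFieldHamiltonian (d := d) L n 0 0 0 -
        ((xyzRealFieldHamiltonian L n 1 (-1) (0 : TorusSite d L → ℝ)).groundEnergy : ℂ) • 1) -
      (α : ℂ) • (xyzRealFieldHamiltonian L n 1 (-1) 0 - xyzRealFieldHamiltonian L n 0 0 0)).PosSemidef := by
  set e₁ := (xyzRealFieldHamiltonian L n 1 (-1) (0 : TorusSite d L → ℝ)).groundEnergy with he₁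
  obtain ⟨V, hVV, hVA, hVB⟩ := exists_conj_antisymm_flipOp L n hL (e₁ : ℂ)
  have hVB' : V * ((α : ℂ) • (xyzRealFieldHamiltonian (d := d) L n 1 (-1) 0 -
      xyzRealFieldHamiltonian L n 0 0 0)) * Vᴴ =
      -((α : ℂ) • (xyzRealFieldHamiltonian L n 1 (-1) 0 - xyzRealFieldHamiltonian L n 0 0 0)) := by
    rw [Matrix.mul_smul, Matrix.smul_mul, hVB, smul_neg]
  refine Matrix.pm_le_of_conj_antisymm hα hVA hVB' ?_
  have hsum : xyzRealFieldHamiltonian L n 0 0 0 - (e₁ : ℂ) • (1 : Op (TorusSite d L) (n + 1)) +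
      ((α⁻¹ : ℝ) : ℂ) • ((α : ℂ) • (xyzRealFieldHamiltonian (d := d) L n 1 (-1) 0 -
        xyzRealFieldHamiltonian L n 0 0 0)) =
      xyzRealFieldHamiltonian L n 1 (-1) 0 - (e₁ : ℂ) • 1 := by
    rw [smul_smul, ← Complex.ofReal_mul, inv_mul_cancel₀ hα.ne', Complex.ofReal_one, one_smul]
    abel
  rw [hsum]
  have h := Matrix.posSemidef_sub_groundEnergy (xyzRealFieldHamiltonian_isHermitian L n 1 (-1) (0 : TorusSite d L → ℝ))
  rwa [Algebra.algebraMap_eq_smul_one, RCLike.real_smul_eq_coe_smul (K := ℂ)] at h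

end Antisymmetry

/-! ### §5 The overlap bound (FL Prop. 3.4: `Cᵢ ≤ σ^{2d}`) -/

section Overlap

variable {d : ℕ} (L : ℕ) [NeZero L] (n : ℕ)

/-- **Fröhlich–Lieb, Proposition 3.4 (operator form, explicit constants).** On the even torus
`(ℤ/Lℤ)^d`, let `0 ≤ α`, let `Q = diagonal W` be a `0/1` diagonal projection all of whose basis
states have Ising-type energy `≥ E(Ω) + G` (FL's `P_Λ`, `ℰ^z(P_Λ) - (e₀^z - e₀(1)) ≥ G`, (3.30)),
let `t > 1`, `Δ' > 0` (FL's `n`, `Δ|Λ|`) and suppose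
`σ̄ := α·(dn L^d/2 + tΔ')/((t-1)Δ') < 1` ((3.29), with `e₀^z - e₀(1) ≤ (n/2)·#bonds ≤ dnL^d/2`
from the Casimir bound). Then every unit eigenvector `ψ` of `H(α) = -Σ(αS¹S¹ - αS²S² + S³S³)` with
eigenvalue `e ≤ E(Ω) + Δ'` ((3.25)) satisfies `Re⟨ψ, Qψ⟩ ≤ σ̄^{2m}` for every number of steps
`m ≥ 1` with `(m-1)·4dn + tΔ' ≤ G` (Lemma 3.3 (2), Cor. 3.2 with `A = H^z - e₀(1)`, `B = αB₀`,
`ε = α`, `λ = e - e₀(1)`, `ρ = e₀^z - e₀(1) + tΔ'`).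
[cite: FrohlichLieb1978, Prop. 3.4, Lemma 3.3, Cor. 3.2, eqs. (3.18)–(3.35)] -/
theorem anisoAF_overlap_le (hL : Even L) {α : ℝ} (hα : 0 ≤ α)
    {W : TensorIndex (TorusSite d L) (n + 1) → ℂ} (hW : ∀ σ, W σ = 0 ∨ W σ = 1) {G : ℝ}
    (hWG : ∀ σ, W σ ≠ 0 →
      isingTypeEnergy n L (fun _ : TorusSite d L => (0 : Fin (n + 1))) + G ≤ isingTypeEnergy n L σ)
    {t Δ' : ℝ} (ht : 1 < t) (hΔ : 0 < Δ')
    (hσ : α * ((d : ℝ) * n * (L : ℝ) ^ d / 2 + t * Δ') / ((t - 1) * Δ') < 1)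
    {m : ℕ} (hm : 1 ≤ m) (hmG : ((m - 1 : ℕ) : ℝ) * (4 * d * n) + t * Δ' ≤ G)
    {ψ : TensorIndex (TorusSite d L) (n + 1) → ℂ} {e : ℝ}
    (hψ : xyzRealFieldHamiltonian L n α (-α) 0 *ᵥ ψ = (e : ℂ) • ψ) (hψ1 : star ψ ⬝ᵥ ψ = 1)
    (he : e ≤ isingTypeEnergy n L (fun _ : TorusSite d L => (0 : Fin (n + 1))) + Δ') :
    (star ψ ⬝ᵥ diagonal W *ᵥ ψ).re ≤
      (α * ((d : ℝ) * n * (L : ℝ) ^ d / 2 + t * Δ') / ((t - 1) * Δ')) ^ (2 * m) := by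
  -- notation (FL (3.18)–(3.20), (3.24))
  set H0 := xyzRealFieldHamiltonian (d := d) L n 0 0 0 with hH0
  set H1 := xyzRealFieldHamiltonian (d := d) L n 1 (-1) 0 with hH1
  set B₀ := H1 - H0 with hB₀
  set e₁ := H1.groundEnergy with he₁
  set E : TensorIndex (TorusSite d L) (n + 1) → ℝ := isingTypeEnergy n L with hE
  set EΩ := isingTypeEnergy n L (fun _ : TorusSite d L => (0 : Fin (n + 1))) with hEΩ
  set A := H0 - (e₁ : ℂ) • (1 : Op (TorusSite d L) (n + 1)) with hAdef
  set B := (α : ℂ) • B₀ with hBdef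
  set σb := α * ((d : ℝ) * n * (L : ℝ) ^ d / 2 + t * Δ') / ((t - 1) * Δ') with hσb
  -- `A` is diagonal and nonnegative ((3.19), (3.21))
  have hAd : A = diagonal fun σ => (((E σ - e₁ : ℝ)) : ℂ) :=
    xyzRealFieldHamiltonian_zero_sub_eq_diagonal L n e₁
  have hApsd : A.PosSemidef := xyzRealFieldHamiltonian_zero_sub_groundEnergy_posSemidef L n
  -- `B` is Hermitian ((3.20))
  have hr : ∀ r : ℝ, IsSelfAdjoint (r : ℂ) := fun r => by
    rw [isSelfAdjoint_iff, Complex.star_def, Complex.conj_ofReal]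
  have hB₀h : B₀.IsHermitian :=
    (xyzRealFieldHamiltonian_isHermitian L n 1 (-1) 0).sub (xyzRealFieldHamiltonian_isHermitian L n 0 0 0)
  have hBh : B.IsHermitian := hB₀h.smul (hr α)
  -- `±B ≤ αA` ((3.22)–(3.23))
  have hpm : ((α : ℂ) • A + B).PosSemidef ∧ ((α : ℂ) • A - B).PosSemidef := by
    rcases hα.eq_or_lt with h0 | hpos
    · have hB0 : B = 0 := by rw [hBdef, ← h0, Complex.ofReal_zero, zero_smul]
      rw [hB0, ← h0, Complex.ofReal_zero, zero_smul, add_zero, sub_zero]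
      exact ⟨PosSemidef.zero, PosSemidef.zero⟩
    · exact flipOp_pm_le L n hL hpos
  -- `α < 1` (from `σ̄ < 1`: the ratio is `≥ 1`)
  have hden0 : 0 < (t - 1) * Δ' := mul_pos (by linarith) hΔ
  have hnum0 : 0 ≤ (d : ℝ) * n * (L : ℝ) ^ d / 2 := by positivity
  have hα1 : α < 1 := by
    have hratio : 1 ≤ ((d : ℝ) * n * (L : ℝ) ^ d / 2 + t * Δ') / ((t - 1) * Δ') := by
      rw [le_div_iff₀ hden0]; nlinarith
    have : α ≤ σb := by
      rw [hσb, mul_div_assoc]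
      exact le_mul_of_one_le_right hα hratio
    exact this.trans_lt hσ
  -- `A + B = H(α) - e₀(1) ≥ 0`, the eigen-equation and `λ = e - e₀(1) ≥ 0` ((3.11), (3.26))
  have hAB : A + B = xyzRealFieldHamiltonian L n α (-α) 0 - (e₁ : ℂ) • 1 := by
    rw [xyzRealFieldHamiltonian_aniso_eq, hAdef, hBdef, hB₀, hH0, hH1]
    abel
  have hABpsd : (A + B).PosSemidef := by
    have hsplit : A + B = ((1 - α : ℝ) : ℂ) • A + ((α : ℂ) • A + B) := by
      push_cast
      rw [sub_smul, one_smul]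
      abel
    rw [hsplit]
    exact (hApsd.smul (Complex.zero_le_real.2 (by linarith))).add hpm.1
  set lam := e - e₁ with hlam
  have hψ' : (A + B) *ᵥ ψ = (lam : ℂ) • ψ := by
    rw [hAB, sub_mulVec, hψ, smul_mulVec, one_mulVec, hlam, Complex.ofReal_sub, sub_smul]
  have hlam0 : 0 ≤ lam := by
    have h := (Complex.nonneg_iff.1 (hABpsd.dotProduct_mulVec_nonneg ψ)).1
    rwa [hψ', dotProduct_smul, hψ1, smul_eq_mul, mul_one, Complex.ofReal_re] at h
  -- `ρ = (e₀^z - e₀(1)) + tΔ'` ((3.24)) and `ερ/(ρ - λ) ≤ σ̄ < 1` ((3.29))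
  set ρ₀ := EΩ - e₁ with hρ₀
  have hρ₀0 : 0 ≤ ρ₀ := sub_nonneg.2 (groundEnergy_xyzRealFieldHamiltonian_aniso_le L n 1)
  have hρ₀le : ρ₀ ≤ (d : ℝ) * n * (L : ℝ) ^ d / 2 := by
    have h1 := neg_le_groundEnergy_xyzRealFieldHamiltonian_one L n (d := d)
    have h2 : (((torusGraph d L).edgeFinset.card : ℕ) : ℝ) ≤ d * (L : ℝ) ^ d := by
      exact_mod_cast card_edgeFinset_torusGraph_le L
    have h3 : (0 : ℝ) ≤ ((torusGraph d L).edgeFinset.card : ℕ) := Nat.cast_nonneg _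
    have hn : (0 : ℝ) ≤ n := Nat.cast_nonneg _
    rw [hρ₀, hEΩ, isingTypeEnergy_zero]
    nlinarith
  set ρ := ρ₀ + t * Δ' with hρdef
  have hlamle : lam ≤ ρ₀ + Δ' := by rw [hlam, hρ₀]; linarith
  have htΔ : Δ' < t * Δ' := by nlinarith
  have hρlam : lam < ρ := by rw [hρdef]; linarith
  have hden : (t - 1) * Δ' ≤ ρ - lam := by rw [hρdef]; linarith
  have hσle : α * ρ / (ρ - lam) ≤ σb := by
    rw [hσb]
    exact div_le_div₀ (mul_nonneg hα (by linarith))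
      (mul_le_mul_of_nonneg_left (by rw [hρdef]; linarith) hα) hden0 hden
  have hσ' : α * ρ / (ρ - lam) < 1 := hσle.trans_lt hσ
  have hq0 : 0 ≤ α * ρ / (ρ - lam) := div_nonneg (mul_nonneg hα (by linarith)) (by linarith)
  -- `Q = diagonal W` is an orthogonal projection
  have hWstar : star W = W := by
    funext σ
    rw [Pi.star_apply]
    rcases hW σ with h | h <;> rw [h] <;> simp
  have hQh : (diagonal W).IsHermitian := by rw [IsHermitian, diagonal_conjTranspose, hWstar]
  have hQ2 : diagonal W * diagonal W = diagonal W := by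
    rw [diagonal_mul_diagonal]
    congr 1
    funext σ
    rcases hW σ with h | h <;> rw [h] <;> simp
  -- hypothesis (iii) by the lowering bound (Lemma 3.3)
  have hc0 : (0 : ℝ) ≤ 4 * d * n := by positivity
  have hBlow : ∀ σ τ, B σ τ ≠ 0 → (E τ - e₁) - 4 * d * n ≤ E σ - e₁ := by
    intro σ τ hστ
    have hne : B₀ σ τ ≠ 0 := by
      intro h0
      apply hστ
      rw [hBdef, Matrix.smul_apply, h0, smul_zero]
    have h := isingTypeEnergy_sub_le_of_flipOp_apply_ne_zero L n hne
    linarith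
  have hiii : ∀ φ : TensorIndex (TorusSite d L) (n + 1) → ℂ, diagonal W *ᵥ φ = φ → ∀ j < m,
      hApsd.1.spectralProjGe ρ *ᵥ ((B * hApsd.1.resolventGe ρ lam) ^ j *ᵥ φ) =
        (B * hApsd.1.resolventGe ρ lam) ^ j *ᵥ φ := by
    intro φ hφ
    refine hApsd.1.hypothesisIII_of_lowering hAd hc0 hBlow (e := EΩ + G - e₁) (fun σ hσlt => ?_) ?_
    · have hφσ := congrFun hφ σ
      rw [mulVec_diagonal] at hφσ
      rcases hW σ with h0 | h1
      · rw [h0, zero_mul] at hφσ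
        exact hφσ.symm
      · exfalso
        have := hWG σ (by rw [h1]; exact one_ne_zero)
        linarith
    · rw [hρdef, hρ₀]
      linarith
  have hmain := Matrix.FrohlichLieb_exponentialLocalization_proj hApsd hBh hα hα1 hpm.2 hpm.1 hψ'
    hψ1 hlam0 hρlam hσ' hQh hQ2 hm hiii
  exact hmain.trans (pow_le_pow_left₀ hq0 hσle _)

/-! ### §6 The smallness datum `⟨Q⟩_β ≤ R₋ + R₊` -/

/-- **The constrained Boltzmann weight of the quantum antiferromagnet (FL (3.1)–(3.3), (3.35),
(1.49)–(1.53)).** Under the hypotheses of `anisoAF_overlap_le` and `β ≥ 0`,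
`Re⟨Q⟩_β ≤ σ̄^{2m} + (n+1)^{L^d}·e^{-βΔ'}`: the low-lying eigenvectors (`eᵢ ≤ E(Ω) + Δ'`) have
overlap `≤ σ̄^{2m}` (`R₋`, Prop. 3.4), the others are suppressed by `e^{-βΔ'}` against
`Z ≥ e^{-βE(Ω)}` (`R₊`, (1.49)–(1.51) with Lemma 4.1's trial states).
[cite: FrohlichLieb1978, eqs. (3.1)–(3.3), (3.35), (1.49)–(1.53), Prop. 3.4, Lemma 4.1] -/
theorem anisoAF_constrained_le (hL : Even L) {α : ℝ} (hα : 0 ≤ α) {β : ℝ} (hβ : 0 ≤ β)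
    {W : TensorIndex (TorusSite d L) (n + 1) → ℂ} (hW : ∀ σ, W σ = 0 ∨ W σ = 1) {G : ℝ}
    (hWG : ∀ σ, W σ ≠ 0 →
      isingTypeEnergy n L (fun _ : TorusSite d L => (0 : Fin (n + 1))) + G ≤ isingTypeEnergy n L σ)
    {t Δ' : ℝ} (ht : 1 < t) (hΔ : 0 < Δ')
    (hσ : α * ((d : ℝ) * n * (L : ℝ) ^ d / 2 + t * Δ') / ((t - 1) * Δ') < 1)
    {m : ℕ} (hm : 1 ≤ m) (hmG : ((m - 1 : ℕ) : ℝ) * (4 * d * n) + t * Δ' ≤ G) :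
    (Matrix.gibbsState β (xyzRealFieldHamiltonian L n α (-α) 0) (diagonal W)).re ≤
      (α * ((d : ℝ) * n * (L : ℝ) ^ d / 2 + t * Δ') / ((t - 1) * Δ')) ^ (2 * m) +
        ((n : ℝ) + 1) ^ (L ^ d) * Real.exp (-(β * Δ')) := by
  haveI : Nonempty (TensorIndex (TorusSite d L) (n + 1)) := ⟨fun _ => 0⟩
  have hH := xyzRealFieldHamiltonian_isHermitian L n α (-α) (0 : TorusSite d L → ℝ)
  have hP : (diagonal W).PosSemidef :=
    posSemidef_diagonal_iff.2 fun σ => by rcases hW σ with h | h <;> simp [h]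
  have hP1 : (1 - diagonal W).PosSemidef := by
    rw [← diagonal_one, diagonal_sub]
    exact posSemidef_diagonal_iff.2 fun σ => by rcases hW σ with h | h <;> simp [h]
  have hE' := groundEnergy_xyzRealFieldHamiltonian_aniso_le L n α (d := d)
  have hden0 : 0 < (t - 1) * Δ' := mul_pos (by linarith) hΔ
  have hσ0 : 0 ≤ α * ((d : ℝ) * n * (L : ℝ) ^ d / 2 + t * Δ') / ((t - 1) * Δ') :=
    div_nonneg (mul_nonneg hα (by positivity)) hden0.le
  have hc := pow_nonneg hσ0 (2 * m)
  have hlow : ∀ i, hH.eigenvalues i ≤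
      isingTypeEnergy n L (fun _ : TorusSite d L => (0 : Fin (n + 1))) + Δ' →
      (star (⇑(hH.eigenvectorBasis i) : TensorIndex (TorusSite d L) (n + 1) → ℂ) ⬝ᵥ
        diagonal W *ᵥ ⇑(hH.eigenvectorBasis i)).re ≤
        (α * ((d : ℝ) * n * (L : ℝ) ^ d / 2 + t * Δ') / ((t - 1) * Δ')) ^ (2 * m) :=
    fun i hi => anisoAF_overlap_le L n hL hα hW hWG ht hΔ hσ hm hmG
      (by rw [hH.mulVec_eigenvectorBasis i, RCLike.real_smul_eq_coe_smul (K := ℂ)]; rfl)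
      (ial_star_eigenvectorBasis_dotProduct hH i) hi
  have h := Matrix.gibbsState_re_le_split_gap hH hP hP1 hβ hE' hc hlow
  have hcard : (Fintype.card (TensorIndex (TorusSite d L) (n + 1)) : ℝ) = ((n : ℝ) + 1) ^ (L ^ d) := by
    rw [Fintype.card_fun, Fintype.card_fin, Fintype.card_pi, prod_const, card_univ, ZMod.card,
      Fintype.card_fin]
    push_cast
    ring
  rwa [hcard] at h

end Overlap

end Literature.MathematicalPhysics.QuantumLattice

end
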